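import Summits.CriticalPhenomena.PercolationContinuityZ3.Theorems.Transplant.CayleyCylinderKitDir
import Summits.CriticalPhenomena.PercolationContinuityZ3.Theorems.Transplant.CayleyCylinderCycle
import HarnessLib

/-!
# Cylinders of a Cayley-graph skeleton VI — the signed cycle kit of a small-cylinder edge and its zone radius

builds on p205010 (kernel theorem, internal audit signed; external expert review pending) — nothing in this file uses p205010.
Lane `prim-bschramm`, seat `prim-bschramm-p4` gen 10 (PART C3 of `P4-GENERAL.md`, "tier 2″").  Helper file
(`--supports stmt-CriticalPhenomena-4575 --as helper`).

For `D : CylData₁ Γ S`, `H = Cay(Γ;S)[V_{ℓ+1}]`, enhancement class `E′ = Eenh ℓ` (edges of `H` not inside `‖φ‖_∞ ≤ ℓ`), an `H`-edge `{x,y}`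
inside the small cylinder with `y ≠ x s₀⁻¹`, and a sign `σ = ±1` whose deep height `σℓ` is NOT the `φ₁`-coordinate of `x` or `y`:
**`kit`** — the `SubLoc.CycleKit H E′ x y` made of the column of `x` down to the floor, the signed frame of file V (floor, wall, corner
excursion through an admissible kernel word, ceiling), and the column of `y`; the excursion may visit vertices of height `(ℓ, σℓ)` inside the
small cylinder, which is why the sign is chosen away from the columns, while every frame EDGE still has an endpoint outside (`E′`).  The
whole kit lies in the graph ball of radius `R ℓ = 10(ℓ+1) + Kmax ℓ + 1` about `x` (`kit_Z_subset`; `Kmax` bounds the admissible words of the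
finitely many kernel elements that can close a frame at level `ℓ`, for both signs); column classes as in file III.
-/

noncomputable section

namespace Summit.CriticalPhenomena.PercolationContinuityZ3.Theorems.Transplant

namespace CayCyl

open SimpleGraph Walk SubLoc Literature.Probability.LatticeModels Literature.Probability.Percolation
open Literature.Barriers.CriticalPhenomena (graphBall graphBall_mono mem_graphBall_self graphBall_finite)
open scoped Classical

variable {Γ : Type} [Group Γ] {S : Finset Γ}

namespace CylData₁

variable (D : CylData₁ Γ S)

/-! ## §1 The kit -/

section Kit

variable {ℓ : ℕ} (x y : D.enl.V (ℓ + 1))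

/-- **The enhancement class**: edges of the big cylinder graph not inside the small cylinder `‖φ‖_∞ ≤ ℓ`. [folklore] -/
def Eenh (ℓ : ℕ) : Set (Sym2 (D.enl.V (ℓ + 1))) := {d | d ∈ (D.cylG (ℓ + 1)).edgeSet ∧ ¬ ∀ z ∈ d, D.φ z.1 ∈ box 2 ℓ}

/-- **THE SIGNED CYCLE KIT of an edge `{x, y}` of the small cylinder** (`y ≠ x s₀⁻¹`, sign `σ` with `φ₁ x, φ₁ y ≠ σℓ`). [cite: BalisterBollobasRiordan2014, §"bond percolation" p. 13] -/
def kit {σ : ℤ} (hσ : σ = 1 ∨ σ = -1) (hx : D.φ x.1 ∈ box 2 ℓ) (hy : D.φ y.1 ∈ box 2 ℓ) (hadj : (D.cylG (ℓ + 1)).Adj x y)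
    (hne : y.1 ≠ x.1 * D.s₀⁻¹) (hxσ : D.φ x.1 1 ≠ σ * ℓ) (hyσ : D.φ y.1 1 ≠ σ * ℓ) :
    CycleKit (D.cylG (ℓ + 1)) (D.Eenh ℓ) x y where
  p := D.enl.pV x
  q := D.enl.qV y
  A := D.colA x
  M := D.pathM σ x y hσ
  B := D.colB y
  hA := (isPath_induce_iff _ _).2 (isPath_powWalk _ D.enl.s₀inv_pow_injective _ _)
  hM := bypass_isPath _
  hB := ((isPath_induce_iff _ _).2 (isPath_powWalk _ D.enl.s₀_pow_injective _ _)).reverse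
  hpq := fun h => by
    have h1 := (D.enl.φ_pt x).1; have h2 := (D.enl.φ_qt y).1
    have e : D.enl.pt x = D.enl.qt y := congrArg Subtype.val h
    rw [e, h2] at h1; omega
  hxp := fun h => by
    have h1 := (D.enl.φ_pt x).1
    have hx0 := (mem_box_two.1 hx).1; rw [abs_le] at hx0
    have e : x.1 = D.enl.pt x := congrArg Subtype.val h
    rw [← e, enl_φ] at h1; omega
  hqy := fun h => by
    have h1 := (D.enl.φ_qt y).1
    have hy0 := (mem_box_two.1 hy).1; rw [abs_le] at hy0
    have e : D.enl.qt y = y.1 := congrArg Subtype.val h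
    rw [e, enl_φ] at h1; omega
  hAM := fun w hwA hwM => by
    obtain ⟨i, hi, hw⟩ := D.mem_colA x hwA
    have hfr := (D.frame_mem x y hσ (D.mem_pathM x y hσ hwM)).2
    have hc := D.enl.φ_s₀inv_pow x.1 i
    rw [enl_φ] at hc
    have hxb := mem_box_two.1 hx; rw [abs_le, abs_le] at hxb
    have hwV := D.memV.1 w.2; rw [abs_le, abs_le] at hwV
    rw [mem_box_two, abs_le, abs_le] at hfr
    rw [hw, hc.1, hc.2] at hfr hwV
    have hi' : (i : ℤ) ≤ D.enl.nA x := by exact_mod_cast hi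
    have e := D.enl.nA_eq x; rw [enl_φ] at e
    rcases hfr with hfr | ⟨-, hfr⟩
    · have hinA : i = D.enl.nA x := by omega
      apply Subtype.ext
      rw [hw, hinA]
    · exact absurd hfr hxσ
  hMB := fun w hwM hwB => by
    obtain ⟨j, hj, hw⟩ := D.mem_colB y hwB
    have hfr := (D.frame_mem x y hσ (D.mem_pathM x y hσ hwM)).2
    have hc := D.enl.φ_s₀_pow y.1 j
    rw [enl_φ] at hc
    have hyb := mem_box_two.1 hy; rw [abs_le, abs_le] at hyb
    have hwV := D.memV.1 w.2; rw [abs_le, abs_le] at hwV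
    rw [mem_box_two, abs_le, abs_le] at hfr
    rw [hw, hc.1, hc.2] at hfr hwV
    have hj' : (j : ℤ) ≤ D.enl.nB y := by exact_mod_cast hj
    have e := D.enl.nB_eq y; rw [enl_φ] at e
    rcases hfr with hfr | ⟨-, hfr⟩
    · have hjnB : j = D.enl.nB y := by omega
      apply Subtype.ext
      rw [hw, hjnB]
    · exact absurd hfr hyσ
  hAB := fun w hwA hwB => by
    obtain ⟨i, -, hw1⟩ := D.mem_colA x hwA
    obtain ⟨j, -, hw2⟩ := D.mem_colB y hwB
    have key : x.1 * D.s₀⁻¹ ^ i = y.1 * D.s₀ ^ j := hw1.symm.trans hw2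
    have hG : (mulCayley (S : Set Γ)).Adj x.1 y.1 := hadj
    have hlip := D.enl.lip_adj (D.adj_Sp hG) 0
    rw [abs_le, enl_φ] at hlip
    have h0 := congrArg (fun g => D.φ g 0) key
    have hc1 := (D.enl.φ_s₀inv_pow x.1 i).1; have hc2 := (D.enl.φ_s₀_pow y.1 j).1
    rw [enl_φ] at hc1 hc2
    have h0' : D.φ x.1 0 - i = D.φ y.1 0 + j := by rw [← hc1, ← hc2]; exact h0
    clear h0
    have hij : i + j = 0 ∨ i + j = 1 := by omega
    rcases hij with hij | hij
    · obtain ⟨rfl, rfl⟩ : i = 0 ∧ j = 0 := by omega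
      simp only [pow_zero, mul_one] at key
      exact hG.ne key
    · rcases (show (i = 1 ∧ j = 0) ∨ (i = 0 ∧ j = 1) by omega) with ⟨rfl, rfl⟩ | ⟨rfl, rfl⟩
      · simp only [pow_one, pow_zero, mul_one] at key
        exact hne key.symm
      · simp only [pow_zero, mul_one, pow_one] at key
        exact hne (by rw [key, mul_inv_cancel_right])
  hME := fun d hd => by
    refine ⟨Walk.edges_subset_edgeSet _ hd, fun hall => ?_⟩
    induction d using Sym2.inductionOn with
    | hf a b =>
      rcases D.edges_pathM x y hσ hd with h | h
      · exact h (hall a (Sym2.mem_mk_left _ _))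
      · exact h (hall b (Sym2.mem_mk_right _ _))
  hyx := hadj.symm

/-! ## §2 The zone radius -/

/-- The uniform bound on the admissible words (both signs) of the kernel elements closing a frame at level `ℓ`. [folklore] -/
def Kmax (ℓ : ℕ) : ℕ := (CylData.kball S ℓ).sup (D.admLen 1) + (CylData.kball S ℓ).sup (D.admLen (-1))

/-- **The zone radius** `R ℓ = 10(ℓ+1) + Kmax ℓ + 1`. [folklore] -/
def R (ℓ : ℕ) : ℕ := 10 * (ℓ + 1) + D.Kmax ℓ + 1

variable {σ : ℤ}

/-- The signed step counts are at most `2(ℓ+1)`. [folklore] -/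
theorem counts_le (hσ : σ = 1 ∨ σ = -1) :
    D.enl.nA x ≤ 2 * (ℓ + 1) ∧ D.enl.nB y ≤ 2 * (ℓ + 1) ∧ D.m₁ σ x ≤ 2 * (ℓ + 1) ∧ D.m₂ σ y ≤ 2 * (ℓ + 1) := by
  have hx := D.memV.1 x.2; have hy := D.memV.1 y.2
  rw [abs_le, abs_le] at hx hy
  have e1 := D.enl.nA_eq x; have e2 := D.enl.nB_eq y; have e3 := D.m₁_eq x hσ; have e4 := D.m₂_eq y hσ
  rw [enl_φ] at e1 e2
  refine ⟨by omega, by omega, ?_, ?_⟩ <;> rcases hσ with rfl | rfl <;> omega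

/-- **The closing kernel element lies in the ball of radius `10(ℓ+1)+1`** (back down the wall and the floor, up the column of `x`, across
the edge, up the column of `y`, along the ceiling). [folklore] -/
theorem kel_mem_kball (hσ : σ = 1 ∨ σ = -1) (hadj : (D.cylG (ℓ + 1)).Adj x y) : D.kel σ x y ∈ CylData.kball S ℓ := by
  have hG : (mulCayley (S : Set Γ)).Adj x.1 y.1 := hadj
  have hc := D.counts_le x y hσ
  let W₁ : (mulCayley (S : Set Γ)).Walk (D.enl.pt x) (D.c₂ σ x) :=
    (powWalk S (D.adj_t σ) (D.enl.pt x) (D.m₁ σ x)).append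
      (powWalk S (fun g => adj_mul_of_mem S (t := D.enl.s₀) (Or.inl D.s₀_mem) D.enl.s₀_ne_one g) (D.c₁ σ x) (2 * (ℓ + 1)))
  let W₂ : (mulCayley (S : Set Γ)).Walk x.1 (D.enl.pt x) :=
    powWalk S (fun g => adj_mul_of_mem S (t := D.enl.s₀⁻¹) (Or.inl (D.inv_mem _ D.s₀_mem)) (inv_ne_one.2 D.enl.s₀_ne_one) g) x.1 (D.enl.nA x)
  let W₃ : (mulCayley (S : Set Γ)).Walk y.1 (D.enl.qt y * D.t σ ^ D.m₂ σ y) :=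
    (powWalk S (fun g => adj_mul_of_mem S (t := D.enl.s₀) (Or.inl D.s₀_mem) D.enl.s₀_ne_one g) y.1 (D.enl.nB y)).append
      (powWalk S (D.adj_t σ) (D.enl.qt y) (D.m₂ σ y))
  let W : (mulCayley (S : Set Γ)).Walk (D.c₂ σ x) (D.enl.qt y * D.t σ ^ D.m₂ σ y) :=
    W₁.reverse.append (W₂.reverse.append (Walk.cons hG W₃))
  have hlen : W.length ≤ 10 * (ℓ + 1) + 1 := by
    simp only [W, W₁, W₂, W₃, Walk.length_append, Walk.length_reverse, Walk.length_cons, length_powWalk]; omega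
  rw [CylData.kball, Set.Finite.mem_toFinset]
  refine ⟨(lmul S (D.c₂ σ x)⁻¹ W).copy (inv_mul_cancel _) (by rw [kel]; simp only [mul_assoc]), ?_⟩
  rw [length_copy, length_lmul]
  exact hlen

/-- The admissible word of the kit is bounded by `Kmax`. [folklore] -/
theorem admLen_kel_le (hσ : σ = 1 ∨ σ = -1) (hadj : (D.cylG (ℓ + 1)).Adj x y) : D.admLen σ (D.kel σ x y) ≤ D.Kmax ℓ := by
  have hmem := D.kel_mem_kball x y hσ hadj
  rcases hσ with rfl | rfl
  · exact (Finset.le_sup (f := D.admLen 1) hmem).trans (Nat.le_add_right _ _)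
  · exact (Finset.le_sup (f := D.admLen (-1)) hmem).trans (Nat.le_add_left _ _)

/-- The frame path is short: `|M| ≤ 6(ℓ+1) + Kmax`. [folklore] -/
theorem length_pathM_le (hσ : σ = 1 ∨ σ = -1) (hadj : (D.cylG (ℓ + 1)).Adj x y) :
    (D.pathM σ x y hσ).length ≤ 6 * (ℓ + 1) + D.Kmax ℓ := by
  refine (length_bypass_le_length _).trans ?_
  rw [length_induce, length_frame]
  have hc := D.counts_le x y hσ
  have hk := D.admLen_kel_le x y hσ hadj
  omega

/-- **The whole kit lies in the ball of radius `R ℓ` about `x`.** [folklore] -/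
theorem kit_Z_subset (hσ : σ = 1 ∨ σ = -1) (hx : D.φ x.1 ∈ box 2 ℓ) (hy : D.φ y.1 ∈ box 2 ℓ) (hadj : (D.cylG (ℓ + 1)).Adj x y)
    (hne : y.1 ≠ x.1 * D.s₀⁻¹) (hxσ : D.φ x.1 1 ≠ σ * ℓ) (hyσ : D.φ y.1 1 ≠ σ * ℓ) :
    (D.kit x y hσ hx hy hadj hne hxσ hyσ).Z ⊆ graphBall (D.cylG (ℓ + 1)) x (D.R ℓ) := by
  have hc := D.counts_le x y hσ
  have hA : (D.colA x).length = D.enl.nA x := (length_induce _ _).trans (length_powWalk _ _ _)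
  have hB : (D.colB y).length = D.enl.nB y := (Walk.length_reverse _).trans ((length_induce _ _).trans (length_powWalk _ _ _))
  have hM := D.length_pathM_le x y hσ hadj
  rintro w (hw | hw | hw)
  · refine ⟨(D.colA x).takeUntil w hw, ?_⟩
    have := (D.colA x).length_takeUntil_le_length hw
    unfold R; omega
  · refine ⟨(D.colA x).append ((D.pathM σ x y hσ).takeUntil w hw), ?_⟩
    have := (D.pathM σ x y hσ).length_takeUntil_le_length hw
    rw [Walk.length_append]; unfold R; omega
  · have hw' : w ∈ (D.colB y).reverse.support := (mem_support_reverse_iff _ w).2 hw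
    refine ⟨Walk.cons hadj ((D.colB y).reverse.takeUntil w hw'), ?_⟩
    have := (D.colB y).reverse.length_takeUntil_le_length hw'
    rw [length_reverse] at this
    rw [Walk.length_cons]; unfold R; omega

/-! ## §3 Column classes -/

/-- The column of `x` lies in the class of `x`. [folklore] -/
theorem cls_colA {w : D.enl.V (ℓ + 1)} (hw : w ∈ (D.colA x).support) : D.enl.cls w.1 = D.enl.cls x.1 := by
  obtain ⟨i, -, h⟩ := D.mem_colA x hw
  rw [h, inv_pow, ← zpow_natCast, ← zpow_neg, D.enl.cls_mul_s₀_zpow]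

/-- The column of `y` lies in the class of `y`. [folklore] -/
theorem cls_colB {w : D.enl.V (ℓ + 1)} (hw : w ∈ (D.colB y).support) : D.enl.cls w.1 = D.enl.cls y.1 := by
  obtain ⟨j, -, h⟩ := D.mem_colB y hw
  rw [h, ← zpow_natCast, D.enl.cls_mul_s₀_zpow]

end Kit

end CylData₁

end CayCyl

end Summit.CriticalPhenomena.PercolationContinuityZ3.Theorems.Transplant

end
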